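import Mathlib
import HarnessLib
import Literature.AlgebraicGeometry.Resolution.Lipman1969RationalSurfaceSingularities
import Literature.AlgebraicGeometry.Resolution.ResolutionFibreDimension
import Literature.AlgebraicGeometry.Motives.CartierDivisor
import Summits.ResolutionOfSingularities.ResolutionOfSingularities.Theorems.HomologicalConductorNoZenoCaPrincipalSky

/-!
# Crux `NoZenoR` / `NoZeno` (stmt-ResolutionOfSingularities-19943 / -16483), line `sandwich-cluster`,
# S3 G-layer target Gb `stubG_carriedPrincipal` — the LIPMAN HALF: an `X_min`-carried ideal is
# principal at every point of the closed fibre (assembly, and its stalk-level end)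

Route `ResolutionOfSingularities/HomologicalConductor`.  OURS (cell res-hironaka, crux chain W4.4, seat
res-D-pv-026 as res-L0-w44-stub-9, owner of Gb per res-L0-w44-lead-1 KERNEL-L0 §16 R6 / skeleton v18);
nothing here is a statement of the manuscript under review (Hironaka 2017); AI-written, weaker than
expert review.  Target of record: `Sig.stubG_carriedPrincipal` (HOME L/res-L0-w44-lead-1/G-targets-v18.txt):
for a singular sandwiched stage `T = T_m`, a minimal resolution `π : X ⟶ Spec T`, a cycle `Z : X → ℕ`
and an ideal `I` of `T` CARRIED by `Z` (`t ∈ I ↔ t = 0 ∨ ord_η t ≥ Z η` at every codimension-one point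
`η` of the closed fibre), the extension `I · 𝒪_{X,x}` is principal at every point `x` of the closed
fibre.

Mathematics (THEOREM Q-rat, res-L0-w44-idea-1, §1 (F4)/(A5); Lipman 1969 Thm. (12.1) (ii)): replace
`Z` by the gcd cycle `Z'` of `I` (`I = I_{Z'}`, Laufer; tree `…NoZenoSkyPrincipalAssembly`), let
`D` be the Cartier divisor `-Z'` on the regular `X`; then `Γ(X, 𝒪_X(D)) = I` (`H⁰(X, 𝒪_X) = T`,
`T` normal) and `(𝒪_X(D) · E) ≥ 0` for every exceptional curve `E` (at the generic point of `E` some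
`t ∈ I` attains `Z'`, so `D + div t` is effective without `E` in its support); `X` being a resolution
of a RATIONAL singularity (`H¹(X, 𝒪_X) = 0`, Lipman (1.2)) with fibres of dimension `≤ 1`, Lipman's
(12.1) (ii) makes `𝒪_X(D)` generated by its global sections, i.e. by `I`; at each `x` one section
`s ∈ I` generates `𝒪_X(D)_x ⊇ I · 𝒪_{X,x} ∋ s`, so `I · 𝒪_{X,x} = s · 𝒪_{X,x}`.

This file proves the END of that argument and the ASSEMBLY, kernel-checked, with the remaining
G-layer inputs as explicit hypotheses (each the deliverable of a named seat):

* `exists_gcd_cycle` — the gcd cycle `Z'` of a valuation set over an abstract exceptional datum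
  (`Z ≤ Z'`, `I_Z = I_{Z'}`, each `Z' i` attained by a nonzero element): Laufer's hull in the form
  used here, with NO intersection matrix;
* `toFunctionField_germ_appTop` — the structure map `T → 𝒪_{X,x}` followed by `𝒪_{X,x} ↪ K(X)` is
  `baseToFunctionField π`;
* `map_germ_appTop_eq_span_of_forall_isRegularAt_div` — if some `s₀ ∈ I` divides every `t ∈ I` in
  `𝒪_{X,x}` (the rational function `t / s₀` is regular at `x`), then `I · 𝒪_{X,x} = s₀ · 𝒪_{X,x}`;
* `isPrincipal_map_germ_appTop_of_isSection` — if `I` maps into the global sections of `𝒪_X(D)`,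
  every nonzero global section comes from `I`, and some global section generates `𝒪_X(D)` at `x`
  (Lipman's «generated by its sections over `X`» at `x`), then `I · 𝒪_{X,x}` is principal;
* `carriedPrincipal_of_divisor` — **Gb modulo its G-layer inputs**, for any Noetherian local domain
  `T` of Krull dimension `≤ 2` and resolution `π : X ⟶ Spec T`: given (P3) a Cartier divisor `D`
  with `Γ(X, 𝒪_X(D)) = {s regular everywhere | s = 0 ∨ ord_η s ≥ Z η on the closed-fibre curves}`
  and `(𝒪_X(D) · E) ≥ 0` on the integral exceptional curves (the divisor `-Z` of a gcd cycle —
  rows G1 (i)/stub-9), (P4) `H⁰(X, 𝒪_X) = T` (every everywhere-regular rational function is a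
  `baseToFunctionField π t`), (P5) `H¹(X, 𝒪_X) = 0` (`HasTrivialCechH1 π`, row G0 + Lipman (1.2)),
  and the named fact `Lipman1969_12_1_ii`, an ideal `I` carried by `Z` is principal at every point
  of the closed fibre (fibre dimension from the tree, `IsResolution.topologicalKrullDim_fiber_le_one`);
* `carriedPrincipal_tower_of_divisor` — the same at a singular stage `T_m` of the sandwich context
  with the binders of `Sig.stubG_carriedPrincipal` (instances `IsNoetherianRing`, `IsLocalRing`,
  `ringKrullDim ≤ 2` of the stage discharged from the tree).

What is NOT here (next files of this row): (P3) the divisor of a cycle with its section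
characterisation and the non-negativity of its degrees at a gcd cycle; (P4) `H⁰(X, 𝒪_X) = T` for a
proper birational `X` over the normal `T`; the closing `Sig.stubG_carriedPrincipal` by name.

References: J. Lipman, Publ. Math. IHÉS 36 (1969), Thm. (12.1) (ii) (p. 220), Prop. (1.2) (p. 199)
[`Lipman1969`]; res-L0-w44-idea-1, THEOREM Q-rat §1 (F4), §2 (A5) (OURS, 2026-08-27).
-/

noncomputable section

-- single-problem summit: the doubled namespace component `ResolutionOfSingularities` is forced
set_option linter.dupNamespace false

namespace Summit.ResolutionOfSingularities.ResolutionOfSingularities.Theorems.NoZeno.SandwichCluster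

open CategoryTheory AlgebraicGeometry TopologicalSpace IsLocalRing
open Literature.AlgebraicGeometry.Resolution Literature.AlgebraicGeometry.Motives
open Summit.ResolutionOfSingularities.ResolutionOfSingularities.Theorems
open Summit.ResolutionOfSingularities.ResolutionOfSingularities.Theorems.NoZeno.Birth

universe u

/-! ## §0 The gcd cycle of a valuation set (Laufer's hull without intersection numbers) -/

section Gcd

variable {k K : Type} [Field k] [Field K] [Algebra k K]

/-- **The gcd cycle.**  For an abstract exceptional datum `v : ι → K → ℕ∞` on a `k`-subalgebra `T`
(`v i 0 = ⊤`, finite values on `T ∖ 0`) and a cycle `Z` whose valuation set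
`I_Z = {a ∈ T | ∀ i, Z i ≤ v i a}` contains a nonzero element, the gcd cycle
`Z' i := min {v_i(a) : a ∈ I_Z, a ≠ 0}` satisfies `Z ≤ Z'`, `I_Z = I_{Z'}`, and each `Z' i` is ATTAINED
by a nonzero element of `I_Z` — the form of Laufer's hull used with Lipman's (12.1) (ii): at the
generic point of `E_i` the divisor `-Z' + div(a_i)` is effective without `E_i` in its support, so
`(𝒪_X(-Z') · E_i) ≥ 0` with no intersection matrix. [folklore] -/
theorem exists_gcd_cycle {ι : Type*} (T : Subalgebra k K) (v : ι → K → ℕ∞)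
    (hzero : ∀ i, v i 0 = ⊤) (hfin : ∀ i, ∀ a ∈ T, a ≠ 0 → v i a ≠ ⊤)
    (Z : ι → ℕ) (hne : ∃ a ∈ T, a ≠ 0 ∧ ∀ i, (Z i : ℕ∞) ≤ v i a) :
    ∃ Z' : ι → ℕ, (∀ i, Z i ≤ Z' i) ∧
      (∀ a : K, (a ∈ T ∧ ∀ i, (Z i : ℕ∞) ≤ v i a) ↔ (a ∈ T ∧ ∀ i, (Z' i : ℕ∞) ≤ v i a)) ∧
      ∀ i, ∃ a ∈ T, a ≠ 0 ∧ (∀ j, (Z j : ℕ∞) ≤ v j a) ∧ v i a = Z' i := by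
  classical
  set V : ι → Set ℕ := fun i =>
    {n | ∃ a ∈ T, a ≠ 0 ∧ (∀ i', (Z i' : ℕ∞) ≤ v i' a) ∧ (v i a).toNat = n} with hV
  have hVne : ∀ i, (V i).Nonempty := fun i => by
    obtain ⟨a, haT, ha0, haZ⟩ := hne
    exact ⟨(v i a).toNat, a, haT, ha0, haZ, rfl⟩
  have hinf_le : ∀ i, ∀ a ∈ T, a ≠ 0 → (∀ i', (Z i' : ℕ∞) ≤ v i' a) → sInf (V i) ≤ (v i a).toNat :=
    fun i a haT ha0 haZ => Nat.sInf_le ⟨a, haT, ha0, haZ, rfl⟩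
  refine ⟨fun i => sInf (V i), fun i => ?_, fun a => ⟨fun ⟨haT, haZ⟩ => ⟨haT, fun i => ?_⟩,
    fun ⟨haT, haZ'⟩ => ⟨haT, fun i => ?_⟩⟩, fun i => ?_⟩
  · obtain ⟨a, haT, ha0, haZ, ha⟩ := Nat.sInf_mem (hVne i)
    have h := haZ i
    rw [← ENat.coe_toNat (hfin i a haT ha0), Nat.cast_le, ha] at h
    exact h
  · by_cases ha0 : a = 0
    · rw [ha0, hzero i]; exact le_top
    · rw [← ENat.coe_toNat (hfin i a haT ha0), Nat.cast_le]
      exact hinf_le i a haT ha0 haZ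
  · obtain ⟨a', ha'T, ha'0, ha'Z, ha'⟩ := Nat.sInf_mem (hVne i)
    have h := ha'Z i
    rw [← ENat.coe_toNat (hfin i a' ha'T ha'0), Nat.cast_le, ha'] at h
    exact (Nat.cast_le.mpr h).trans (haZ' i)
  · obtain ⟨a, haT, ha0, haZ, ha⟩ := Nat.sInf_mem (hVne i)
    exact ⟨a, haT, ha0, haZ, by rw [← ENat.coe_toNat (hfin i a haT ha0), ha]⟩

end Gcd

/-! ## §1 The stalk-level end of the argument -/

section Stalk

variable {X : Scheme.{u}} [IsIntegral X] {T : Type u} [CommRing T] (π : X ⟶ Spec (.of T))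

/-- The structure map `T ≅ Γ(Spec T) → Γ(X, 𝒪_X) → 𝒪_{X,x}` followed by the inclusion
`𝒪_{X,x} ↪ K(X)` is `baseToFunctionField π` (the germ of a global section at `x`, read in `K(X)`, is
its germ at the generic point). [folklore] -/
theorem toFunctionField_germ_appTop (x : X) (t : T) :
    RatFn.toFunctionField x (((X.presheaf.germ ⊤ x trivial).hom.comp
      (π.appTop.hom.comp (Scheme.ΓSpecIso (.of T)).inv.hom)) t) = baseToFunctionField π t := by
  change RatFn.toFunctionField x (X.presheaf.germ ⊤ x trivial
      (Literature.AlgebraicGeometry.Morphisms.algebraMapΓ π t)) =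
    X.presheaf.germ ⊤ (genericPoint X) trivial (Literature.AlgebraicGeometry.Morphisms.algebraMapΓ π t)
  exact RatFn.toFunctionField_germ (Set.mem_univ x) _

/-- An element of `T` is regular at every point of `X` (it is a global function). [folklore] -/
theorem isRegularAt_baseToFunctionField (x : X) (t : T) :
    RatFn.IsRegularAt x (baseToFunctionField π t) :=
  ⟨_, toFunctionField_germ_appTop π x t⟩

/-- **`I · 𝒪_{X,x} = s₀ · 𝒪_{X,x}` when `s₀ ∈ I` divides `I` at `x`.**  If `s₀ ∈ I` is nonzero in
`K(X)` and `t / s₀` is regular at `x` for every `t ∈ I`, the extension of `I` along the structure map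
`T → 𝒪_{X,x}` is generated by the image of `s₀`. [folklore] -/
theorem map_germ_appTop_eq_span_of_forall_isRegularAt_div (x : X) (I : Ideal T) {s₀ : T}
    (hs₀I : s₀ ∈ I) (hs₀ : baseToFunctionField π s₀ ≠ 0)
    (hdiv : ∀ t ∈ I, RatFn.IsRegularAt x (baseToFunctionField π t / baseToFunctionField π s₀)) :
    Ideal.map (((X.presheaf.germ ⊤ x trivial).hom.comp
      (π.appTop.hom.comp (Scheme.ΓSpecIso (.of T)).inv.hom)) : T →+* X.presheaf.stalk x) I =
    Ideal.span {(((X.presheaf.germ ⊤ x trivial).hom.comp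
      (π.appTop.hom.comp (Scheme.ΓSpecIso (.of T)).inv.hom)) : T →+* X.presheaf.stalk x) s₀} := by
  set φ : T →+* X.presheaf.stalk x := ((X.presheaf.germ ⊤ x trivial).hom.comp
      (π.appTop.hom.comp (Scheme.ΓSpecIso (.of T)).inv.hom)) with hφ
  refine le_antisymm ?_ ((Ideal.span_singleton_le_iff_mem _).mpr (Ideal.mem_map_of_mem φ hs₀I))
  rw [Ideal.map_le_iff_le_comap]
  intro t ht
  rw [Ideal.mem_comap, Ideal.mem_span_singleton']
  obtain ⟨r, hr⟩ := hdiv t ht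
  refine ⟨r, RatFn.toFunctionField_injective x ?_⟩
  rw [map_mul, hr, hφ, toFunctionField_germ_appTop, toFunctionField_germ_appTop,
    div_mul_cancel₀ _ hs₀]

/-- **Principality from one generating section.**  Let `D` be a Cartier divisor on `X` such that
every `t ∈ I` is a global section of `𝒪_X(D)` (through `T → K(X)`), every nonzero global section of
`𝒪_X(D)` comes from `I`, and some global section `s` generates `𝒪_X(D)` at `x` (`x ∈ X_s`, Lipman's
«`ℒ` generated by its sections over `X`» at the point `x`).  Then `I · 𝒪_{X,x}` is principal,
generated by `s`: for `t ∈ I`, `t / s = (f_i t) / (f_i s)` with `f_i t` regular and `f_i s` a unit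
at `x`. [cite: Lipman1969, Theorem (12.1) (ii) (p. 220)] -/
theorem isPrincipal_map_germ_appTop_of_isSection (x : X) (I : Ideal T) (D : CartierDivisor X)
    (hI : ∀ t ∈ I, D.IsSection (baseToFunctionField π t))
    (hΓ : ∀ s : X.functionField, D.IsSection s → s ≠ 0 → ∃ t ∈ I, baseToFunctionField π t = s)
    (hx : ∃ s : X.functionField, D.IsSection s ∧ x ∈ D.nonvanishing s) :
    (Ideal.map (((X.presheaf.germ ⊤ x trivial).hom.comp
      (π.appTop.hom.comp (Scheme.ΓSpecIso (.of T)).inv.hom)) : T →+* X.presheaf.stalk x)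
        I).IsPrincipal := by
  obtain ⟨s, hs, i, hi, hu⟩ := hx
  have hfs0 : D.f i * s ≠ 0 := hu.ne_zero
  have hs0 : s ≠ 0 := fun h => hfs0 (by rw [h, mul_zero])
  obtain ⟨s₀, hs₀I, hs₀⟩ := hΓ s hs hs0
  have hs₀0 : baseToFunctionField π s₀ ≠ 0 := by rw [hs₀]; exact hs0
  refine ⟨_, (map_germ_appTop_eq_span_of_forall_isRegularAt_div π x I hs₀I hs₀0 fun t ht => ?_).trans
    (Ideal.submodule_span_eq.symm)⟩
  -- `t / s = (f_i · t) / (f_i · s)`: regular times the inverse of a unit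
  have hreg := (hI t ht i x hi).mul hu.inv.isRegularAt
  rw [hs₀]
  convert hreg using 1
  field_simp [D.f_ne_zero i, hs0]

end Stalk

/-! ## §2 The assembly: Lipman (12.1) (ii) on a resolution of a rational surface singularity -/

section Assembly

/-- **Gb modulo its G-layer inputs.**  Let `T` be a Noetherian local domain of Krull dimension
`≤ 2`, `π : X ⟶ Spec T` a resolution (proper, birational, `X` regular; `X` integral and locally
Noetherian) with `H¹(X, 𝒪_X) = 0` (P5: `X` resolves a RATIONAL singularity — every resolution of a
sandwiched stage does, Lipman (1.2)), `Z : X → ℕ` a cycle and `I` an ideal of `T` CARRIED by `Z`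
(membership = `t = 0` or `ord_η t ≥ Z η` at every codimension-one point `η` of the closed fibre).
Suppose given (P3) a Cartier divisor `D` on `X` — «`-Z`» — whose global sections are exactly the
everywhere-regular rational functions `s` with `s = 0 ∨ ord_η s ≥ Z η` at those `η`, and whose degree
on every integral exceptional curve is `≥ 0`, and (P4) `H⁰(X, 𝒪_X) = T`: every everywhere-regular
rational function is in the image of `T`.  Then, by Lipman's Theorem (12.1) (ii) (fibres of `π` have
dimension `≤ 1`: tree `IsResolution.topologicalKrullDim_fiber_le_one`), `𝒪_X(D)` is generated by its
global sections `= I`, and `I · 𝒪_{X,x}` is principal at every point `x` of `X` (in particular on the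
closed fibre). [cite: Lipman1969, Theorem (12.1) (ii) (p. 220)] -/
theorem carriedPrincipal_of_divisor (h121ii : Lipman1969_12_1_ii.{u}) {T : Type u} [CommRing T]
    [IsDomain T] [IsNoetherianRing T] [IsLocalRing T] (hdim : ringKrullDim T ≤ 2)
    {X : Scheme.{u}} [IsIntegral X] [IsLocallyNoetherian X] (π : X ⟶ Spec (.of T))
    (hπ : IsResolution π) (hrat : HasTrivialCechH1 π)
    (Z : X → ℕ) (I : Ideal T)
    (hI : ∀ t : T, t ∈ I ↔ (t = 0 ∨ ∀ η : X, Order.coheight η = 1 →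
      IsLocalHom (((X.presheaf.germ ⊤ η trivial).hom.comp
        (π.appTop.hom.comp (Scheme.ΓSpecIso (.of T)).inv.hom)) : T →+* X.presheaf.stalk η) →
      (Z η : ℤ) ≤ Scheme.ord (baseToFunctionField π t) η))
    (D : CartierDivisor X)
    (hDsec : ∀ s : X.functionField, D.IsSection s ↔ ((∀ x : X, RatFn.IsRegularAt x s) ∧
      (s = 0 ∨ ∀ η : X, Order.coheight η = 1 →
        IsLocalHom (((X.presheaf.germ ⊤ η trivial).hom.comp
          (π.appTop.hom.comp (Scheme.ΓSpecIso (.of T)).inv.hom)) : T →+* X.presheaf.stalk η) →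
        (Z η : ℤ) ≤ Scheme.ord s η)))
    (hDdeg : ∀ η ∈ excCurvePoints π, 0 ≤ excCurveDegree π D η)
    (hH0 : ∀ s : X.functionField, (∀ x : X, RatFn.IsRegularAt x s) → ∃ t : T,
      baseToFunctionField π t = s)
    (x : X) :
    (Ideal.map (((X.presheaf.germ ⊤ x trivial).hom.comp
      (π.appTop.hom.comp (Scheme.ΓSpecIso (.of T)).inv.hom)) : T →+* X.presheaf.stalk x)
        I).IsPrincipal := by
  haveI : IsProper π := hπ.isProper
  -- Lipman (12.1) (ii): non-negative degrees on the exceptional curves ⇒ generated by global sections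
  have hfib : ∀ y : Spec (.of T), topologicalKrullDim (π.fiber y) ≤ 1 :=
    IsResolution.topologicalKrullDim_fiber_le_one hdim hπ
  have hgen : IsGeneratedByGlobalSections D := ((h121ii T X π hfib hrat D).1).mp hDdeg
  refine isPrincipal_map_germ_appTop_of_isSection π x I D (fun t ht => ?_) (fun s hs hs0 => ?_) (hgen x)
  · -- `t ∈ I` is a global section of `𝒪_X(D)`
    rw [hDsec]
    refine ⟨fun y => isRegularAt_baseToFunctionField π y t, ?_⟩
    rcases (hI t).mp ht with h0 | h
    · left; rw [h0, map_zero]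
    · right; exact h
  · -- a nonzero global section comes from `I`
    obtain ⟨hreg, hord⟩ := (hDsec s).mp hs
    obtain ⟨t, rfl⟩ := hH0 s hreg
    refine ⟨t, (hI t).mpr (Or.inr ?_), rfl⟩
    rcases hord with h0 | h
    · exact absurd h0 hs0
    · exact h

end Assembly

/-! ## §3 At a singular stage of the sandwich context (the binders of `Sig.stubG_carriedPrincipal`) -/

section Tower

variable {k K : Type} [Field k] [Field K] [Algebra k K]

/-- **Gb at a stage, modulo its G-layer inputs.**  The binders of `Sig.stubG_carriedPrincipal`
(sandwich context, singular stage `T_m`, `m ≥ m₀ + 1`, minimal resolution `π`, cycle `Z`, carried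
ideal `I`, closed-fibre point `x`) together with the inputs (P3) divisor of the cycle, (P4)
`H⁰(X, 𝒪_X) = T_m`, (P5) `H¹(X, 𝒪_X) = 0` and the fact `Lipman1969_12_1_ii` give
`(I · 𝒪_{X,x}).IsPrincipal`.  The stage is a Noetherian local domain of Krull dimension `≤ 2` by the
tree (`stub_towerNoetherian`, `d2rc_ringKrullDim_tower_le`; locality of the stage — needed to
STATE `excCurvePoints` — is taken as an instance argument, discharged by the caller from
`exists_tower_eq_loc` + `SyzygyFlattening.isLocalRing_locAt`); `x` may be any point of `X` (the
closed-fibre hypothesis of the target is not needed for the conclusion).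
[cite: Lipman1969, Theorem (12.1) (ii) (p. 220)] -/
theorem carriedPrincipal_tower_of_divisor (h121ii : Lipman1969_12_1_ii.{0})
    (O : ValuationSubring K) (A R : Subalgebra k K) (m₀ : ℕ) (ctx : SandwichCtx O A R m₀) (m : ℕ)
    [IsLocalRing ↥(tower O A m)] {X : Scheme.{0}} [IsIntegral X] [IsLocallyNoetherian X]
    (π : X ⟶ Spec (.of ↥(tower O A m))) (hπ : IsMinimalResolution π) (hrat : HasTrivialCechH1 π)
    (Z : X → ℕ) (I : Ideal ↥(tower O A m))
    (hI : ∀ t : ↥(tower O A m), t ∈ I ↔ ((t : K) = 0 ∨ ∀ η : X, Order.coheight η = 1 →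
      IsLocalHom (((X.presheaf.germ ⊤ η trivial).hom.comp
        (π.appTop.hom.comp (Scheme.ΓSpecIso (.of ↥(tower O A m))).inv.hom)) :
          ↥(tower O A m) →+* X.presheaf.stalk η) →
      (Z η : ℤ) ≤ Scheme.ord (baseToFunctionField π t) η))
    (D : CartierDivisor X)
    (hDsec : ∀ s : X.functionField, D.IsSection s ↔ ((∀ x : X, RatFn.IsRegularAt x s) ∧
      (s = 0 ∨ ∀ η : X, Order.coheight η = 1 →
        IsLocalHom (((X.presheaf.germ ⊤ η trivial).hom.comp
          (π.appTop.hom.comp (Scheme.ΓSpecIso (.of ↥(tower O A m))).inv.hom)) :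
            ↥(tower O A m) →+* X.presheaf.stalk η) →
        (Z η : ℤ) ≤ Scheme.ord s η)))
    (hDdeg : ∀ η ∈ excCurvePoints π, 0 ≤ excCurveDegree π D η)
    (hH0 : ∀ s : X.functionField, (∀ x : X, RatFn.IsRegularAt x s) → ∃ t : ↥(tower O A m),
      baseToFunctionField π t = s)
    (x : X) :
    (Ideal.map (((X.presheaf.germ ⊤ x trivial).hom.comp
      (π.appTop.hom.comp (Scheme.ΓSpecIso (.of ↥(tower O A m))).inv.hom)) :
        ↥(tower O A m) →+* X.presheaf.stalk x) I).IsPrincipal := by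
  obtain ⟨hk, hA, hfr, hAO, htr, -⟩ := ctx
  haveI : IsNoetherianRing ↥(tower O A m) := stub_towerNoetherian k K O A hk hA hfr hAO m
  have hdim : ringKrullDim ↥(tower O A m) ≤ 2 := by
    exact_mod_cast d2rc_ringKrullDim_tower_le O A m htr.le
  refine carriedPrincipal_of_divisor h121ii hdim π hπ.isResolution hrat Z I (fun t => ?_) D hDsec
    hDdeg hH0 x
  rw [hI t]
  have h0 : ((t : K) = 0) ↔ t = 0 := by
    rw [← ZeroMemClass.coe_zero (tower O A m), Subtype.coe_inj]
  rw [h0]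

end Tower

/-! ## §4 (appended) The v19 indexing: carried conditions over `excCurvePoints π`

Skeleton file v19 (res-L0-w44-lead-1, 2026-08-27T05:46Z) re-indexes Ga/Gb by stub-4's
`excCurvePoints π` (closed-fibre points with one-dimensional closure) instead of
«`coheight η = 1 ∧ IsLocalHom (toStalk η)`».  The assembly does not look inside the carrier
condition, so we prove it once for an ARBITRARY predicate `C` on `K(X)` («vanishes to order `≥ Z`
along the exceptional curves», in whichever indexing) and specialise. -/

section Pred

/-- **Gb modulo its inputs, for an arbitrary carrier predicate `C`.**  As
`carriedPrincipal_of_divisor`, with the order conditions along the exceptional curves packaged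
into a predicate `C : K(X) → Prop`: `I = {t | t = 0 ∨ C t}`, `Γ(X, 𝒪_X(D)) = {s regular everywhere |
s = 0 ∨ C s}`, degrees of `D` non-negative on the integral exceptional curves, `H⁰(X, 𝒪_X) = T`,
`H¹(X, 𝒪_X) = 0` ⇒ `I · 𝒪_{X,x}` principal at every `x`. [cite: Lipman1969, Theorem (12.1) (ii) (p. 220)] -/
theorem carriedPrincipal_of_divisor_of_pred (h121ii : Lipman1969_12_1_ii.{u}) {T : Type u}
    [CommRing T] [IsDomain T] [IsNoetherianRing T] [IsLocalRing T] (hdim : ringKrullDim T ≤ 2)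
    {X : Scheme.{u}} [IsIntegral X] [IsLocallyNoetherian X] (π : X ⟶ Spec (.of T))
    (hπ : IsResolution π) (hrat : HasTrivialCechH1 π) (C : X.functionField → Prop) (I : Ideal T)
    (hI : ∀ t : T, t ∈ I ↔ (t = 0 ∨ C (baseToFunctionField π t)))
    (D : CartierDivisor X)
    (hDsec : ∀ s : X.functionField, D.IsSection s ↔
      ((∀ x : X, RatFn.IsRegularAt x s) ∧ (s = 0 ∨ C s)))
    (hDdeg : ∀ η ∈ excCurvePoints π, 0 ≤ excCurveDegree π D η)
    (hH0 : ∀ s : X.functionField, (∀ x : X, RatFn.IsRegularAt x s) → ∃ t : T,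
      baseToFunctionField π t = s)
    (x : X) :
    (Ideal.map (((X.presheaf.germ ⊤ x trivial).hom.comp
      (π.appTop.hom.comp (Scheme.ΓSpecIso (.of T)).inv.hom)) : T →+* X.presheaf.stalk x)
        I).IsPrincipal := by
  haveI : IsProper π := hπ.isProper
  have hfib : ∀ y : Spec (.of T), topologicalKrullDim (π.fiber y) ≤ 1 :=
    IsResolution.topologicalKrullDim_fiber_le_one hdim hπ
  have hgen : IsGeneratedByGlobalSections D := ((h121ii T X π hfib hrat D).1).mp hDdeg
  refine isPrincipal_map_germ_appTop_of_isSection π x I D (fun t ht => ?_) (fun s hs hs0 => ?_) (hgen x)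
  · rw [hDsec]
    refine ⟨fun y => isRegularAt_baseToFunctionField π y t, ?_⟩
    rcases (hI t).mp ht with h0 | h
    · left; rw [h0, map_zero]
    · right; exact h
  · obtain ⟨hreg, hC⟩ := (hDsec s).mp hs
    obtain ⟨t, rfl⟩ := hH0 s hreg
    refine ⟨t, (hI t).mpr (Or.inr ?_), rfl⟩
    rcases hC with h0 | h
    · exact absurd h0 hs0
    · exact h

end Pred

section TowerV19

variable {k K : Type} [Field k] [Field K] [Algebra k K]

/-- **Gb at a stage, v19 indexing, modulo its G-layer inputs.**  The binders of
`Sig.stubG_carriedPrincipal` as in skeleton file v19 (`[IsLocalRing ↥(tower O A m)]`, carried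
condition `(t : K) = 0 ∨ ∀ η ∈ excCurvePoints π, Z η ≤ ord_η t`), plus (P3) the divisor `D` of the
cycle with its section characterisation and non-negative degrees, (P4) `H⁰(X, 𝒪_X) = T_m`, (P5)
`H¹(X, 𝒪_X) = 0`, and `Lipman1969_12_1_ii`, give `(I · 𝒪_{X,x}).IsPrincipal` at every `x`.
[cite: Lipman1969, Theorem (12.1) (ii) (p. 220)] -/
theorem carriedPrincipal_tower_of_divisor_exc (h121ii : Lipman1969_12_1_ii.{0})
    (O : ValuationSubring K) (A R : Subalgebra k K) (m₀ : ℕ) (ctx : SandwichCtx O A R m₀) (m : ℕ)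
    [IsLocalRing ↥(tower O A m)] {X : Scheme.{0}} [IsIntegral X] [IsLocallyNoetherian X]
    (π : X ⟶ Spec (.of ↥(tower O A m))) (hπ : IsMinimalResolution π) (hrat : HasTrivialCechH1 π)
    (Z : X → ℕ) (I : Ideal ↥(tower O A m))
    (hI : ∀ t : ↥(tower O A m), t ∈ I ↔ ((t : K) = 0 ∨ ∀ η ∈ excCurvePoints π,
      (Z η : ℤ) ≤ Scheme.ord (baseToFunctionField π t) η))
    (D : CartierDivisor X)
    (hDsec : ∀ s : X.functionField, D.IsSection s ↔ ((∀ x : X, RatFn.IsRegularAt x s) ∧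
      (s = 0 ∨ ∀ η ∈ excCurvePoints π, (Z η : ℤ) ≤ Scheme.ord s η)))
    (hDdeg : ∀ η ∈ excCurvePoints π, 0 ≤ excCurveDegree π D η)
    (hH0 : ∀ s : X.functionField, (∀ x : X, RatFn.IsRegularAt x s) → ∃ t : ↥(tower O A m),
      baseToFunctionField π t = s)
    (x : X) :
    (Ideal.map (((X.presheaf.germ ⊤ x trivial).hom.comp
      (π.appTop.hom.comp (Scheme.ΓSpecIso (.of ↥(tower O A m))).inv.hom)) :
        ↥(tower O A m) →+* X.presheaf.stalk x) I).IsPrincipal := by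
  obtain ⟨hk, hA, hfr, hAO, htr, -⟩ := ctx
  haveI : IsNoetherianRing ↥(tower O A m) := stub_towerNoetherian k K O A hk hA hfr hAO m
  have hdim : ringKrullDim ↥(tower O A m) ≤ 2 := by
    exact_mod_cast d2rc_ringKrullDim_tower_le O A m htr.le
  refine carriedPrincipal_of_divisor_of_pred h121ii hdim π hπ.isResolution hrat
    (fun s => ∀ η ∈ excCurvePoints π, (Z η : ℤ) ≤ Scheme.ord s η) I (fun t => ?_) D hDsec hDdeg hH0 x
  rw [hI t]
  have h0 : ((t : K) = 0) ↔ t = 0 := by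
    rw [← ZeroMemClass.coe_zero (tower O A m), Subtype.coe_inj]
  rw [h0]

end TowerV19

end Summit.ResolutionOfSingularities.ResolutionOfSingularities.Theorems.NoZeno.SandwichCluster

end
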